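import Literature.Geometry.Lorentzian.KerrObstructionOuterLayer
import HarnessLib

/-!
# The inner-layer obstruction of Li–Mei's interior Kerr gluing is `O(ε)`

Support file (all results proved; no named facts) for the named fact `LiMei.interiorKerrGluing`
(`InteriorKerrGluing.lean`; J. Li, H. Mei, *A construction of collapsing spacetimes in vacuum*,
Comm. Math. Phys. 378 (2020) = arXiv:2005.01249, Prop. 4.1), Step S5 of the architecture recorded
in `InteriorKerrGluingReduction.lean`: the constant term `(ε₀, ε₁, ε₂, ε₃) = O(ε)` of Li–Mei's
expansion `𝓘(m, a⃗) = (8π(m − m₀), −8π m₀ a⃗) + (ε₀, ε₁, ε₂, ε₃) + O(ε²)` (p. 25), which comes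
from the INNER cut-off layer, where the variation of the glued datum is `D − (ḡ_M, k̄_M)` and is
`ε`-small in `C⁰` by the hypothesis `NearSchwarzschildCylinder M r₁ r₀ ρ₁ ρ₂ k ε D`.

With the linearised-obstruction integrands `LiMei.timeIntegrandWith` / `LiMei.rotIntegrandWith` of
`KerrObstructionOuterLayer.lean` (functionals of the variation, here
`(coordH D − G₀, coordK D − K₀)` with `(G₀, K₀) = (cylH M 0 r₀ τ₀ R₀, cylK M 0 _ τ₀ R₀)` the
Schwarzschild cylinder) and ANY `C¹` radial profile `χ₀` whose derivative is supported in
`t ≤ |r| ≤ s ⊂ (ρ₁, ρ₂)` (`ρ₁ ≥ 1`; the inner profile `1 − radialCutoff s₁ t₁` qualifies,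
`LiMei.deriv_one_sub_support`), this file proves:

* `LiMei.abs_integral_timeIntegrandWith_data_le` — the `∂_t`-integrand on `(coordH D − G₀,
  coordK D − K₀)` is integrable and **`|∫ (∂_t-integrand)| ≤ C ε`**;
* `LiMei.abs_integral_rotIntegrandWith_data_le` — the same for `Ω_ω`, `‖ω‖ ≤ 1`:
  **`|∫ (Ω_ω-integrand)| ≤ C ε`**,

with `C` depending only on `M, r₀` and `χ₀` (explicitly `C = K ∫ |χ₀'(‖y‖)| dy`).

## References

* J. Li, H. Mei, arXiv:2005.01249, §4, proof of Prop. 4.1, p. 25 (key `LiMei2020`).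
-/

noncomputable section

open Set Filter Function Metric MeasureTheory
open scoped Topology RealInnerProductSpace Real Manifold

namespace Literature.Geometry.Lorentzian

namespace LiMei

attribute [local instance] instNormedAddCommGroupBilinE3 instNormedSpaceBilinE3

/-! ### Profiles with derivative supported in a shell -/

/-- For a profile equal to `1` on `|r| ≤ a` and to `0` on `b ≤ |r|`, `χ₀'(r) ≠ 0` forces
`a ≤ |r| ≤ b`. [folklore] -/
theorem deriv_cutoffProfile_support {χ₀ : ℝ → ℝ} {a b : ℝ} (h1 : ∀ r, |r| ≤ a → χ₀ r = 1)
    (h0 : ∀ r, b ≤ |r| → χ₀ r = 0) (r : ℝ) (h : deriv χ₀ r ≠ 0) : a ≤ |r| ∧ |r| ≤ b :=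
  ⟨le_of_not_gt fun hlt ↦ h (deriv_cutoffProfile_eq_zero_of_abs_lt h1 hlt),
    le_of_not_gt fun hlt ↦ h (deriv_cutoffProfile_eq_zero_of_lt_abs h0 hlt)⟩

/-- **The inner profile**: for `χ₀` equal to `1` on `|r| ≤ a` and to `0` on `b ≤ |r|`, the
derivative of `1 − χ₀` is supported in `a ≤ |r| ≤ b` as well. [folklore] -/
theorem deriv_one_sub_support {χ₀ : ℝ → ℝ} {a b : ℝ} (h1 : ∀ r, |r| ≤ a → χ₀ r = 1)
    (h0 : ∀ r, b ≤ |r| → χ₀ r = 0) (r : ℝ) (h : deriv (fun x ↦ 1 - χ₀ x) r ≠ 0) :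
    a ≤ |r| ∧ |r| ≤ b :=
  deriv_cutoffProfile_support h1 h0 r (by rwa [deriv_const_sub, neg_ne_zero] at h)

/-- The complementary profile of a `C¹` profile is `C¹`. [folklore] -/
theorem contDiff_one_sub {χ₀ : ℝ → ℝ} {n : WithTop ℕ∞} (hχ : ContDiff ℝ n χ₀) :
    ContDiff ℝ n fun x ↦ 1 - χ₀ x :=
  contDiff_const.sub hχ

/-- `y ↦ |χ₀'(‖y‖)|` is integrable on `E3` when `χ₀` is `C¹` with derivative supported in
`|r| ≤ s`. [folklore] -/
theorem integrable_abs_deriv_norm_of_support {χ₀ : ℝ → ℝ} {t s : ℝ} (hχ : ContDiff ℝ 1 χ₀)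
    (hsupp : ∀ r, deriv χ₀ r ≠ 0 → t ≤ |r| ∧ |r| ≤ s) :
    Integrable (fun y : E3 ↦ |deriv χ₀ ‖y‖|) := by
  have hc : Continuous fun y : E3 ↦ |deriv χ₀ ‖y‖| :=
    ((hχ.continuous_deriv le_rfl).comp continuous_norm).abs
  refine hc.integrable_of_hasCompactSupport ?_
  refine HasCompactSupport.intro (K := closedBall (0 : E3) (|s| + 1)) (isCompact_closedBall _ _)
    fun y hy ↦ ?_
  rw [mem_closedBall, dist_zero_right, not_le] at hy
  rw [abs_eq_zero]
  by_contra hne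
  have h := (hsupp ‖y‖ hne).2
  rw [abs_norm] at h
  linarith [le_abs_self s]

/-! ### The `C⁰` closeness of a near-Schwarzschild datum to the cylinder background -/

/-- **`C⁰` closeness from `NearSchwarzschildCylinder`**: on `ρ₁ < ‖y‖ < ρ₂` (`ρ₁ ≥ 1`) the
variation `(coordH D − G₀, coordK D − K₀)` is bounded by `ε` on unit vectors, for any frame of the
Schwarzschild cylinder background. [cite: LiMei2020, Prop. 4.1] -/
theorem unit_bounds_of_nearSchwarzschildCylinder [Kerr.Facts] {M r₁ r₀ ρ₁ ρ₂ : ℝ} {k : ℕ} {ε : ℝ}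
    (hr₁ : r₁ < r₀) (hr₀ : 0 < r₀) (h2M : r₀ < 2 * M) (hρ₁ : 1 ≤ ρ₁) (τ₀ : ℝ) (R₀ : E3 →ₗᵢ[ℝ] E3)
    {D : InitialDataSet (𝓡 3) E3} (hD : NearSchwarzschildCylinder M r₁ r₀ ρ₁ ρ₂ k ε D) {y : E3}
    (hy₁ : ρ₁ < ‖y‖) (hy₂ : ‖y‖ < ρ₂) :
    (∀ v w : E3, ‖v‖ ≤ 1 → ‖w‖ ≤ 1 → |(D.coordH y - cylH M 0 r₀ τ₀ R₀ y) v w| ≤ ε) ∧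
      ∀ v w : E3, ‖v‖ ≤ 1 → ‖w‖ ≤ 1 → |(D.coordK y - cylK M 0 hr₀ τ₀ R₀ y) v w| ≤ ε := by
  have H := (nearSchwarzschildCylinder_iff hr₁ hr₀ h2M hρ₁ D).1 hD
  have hy1 : 1 ≤ ‖y‖ := hρ₁.trans hy₁.le
  have hy1' : 1 < ‖y‖ := lt_of_le_of_lt hρ₁ hy₁
  refine ⟨fun v w hv hw ↦ ?_, fun v w hv hw ↦ ?_⟩
  · have h := (H v w hv hw 0 (Nat.zero_le _) y hy₁ hy₂).1
    rw [norm_iteratedFDeriv_zero, Real.norm_eq_abs] at h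
    rw [sub_apply, sub_apply, InitialDataSet.coordH_apply, cylH_zero_spin_apply hr₀ τ₀ R₀ hy1]
    exact h
  · have h := (H v w hv hw 0 (Nat.zero_le _) y hy₁ hy₂).2
    rw [norm_iteratedFDeriv_zero, Real.norm_eq_abs] at h
    rw [sub_apply, sub_apply, InitialDataSet.coordK_apply, cylK_zero_spin_apply hr₀ h2M τ₀ R₀ hy1']
    exact h

/-- `0 ≤ ε` for a near-Schwarzschild datum on a nonempty shell. [folklore] -/
theorem nonneg_of_nearSchwarzschildCylinder [Kerr.Facts] {M r₁ r₀ ρ₁ ρ₂ : ℝ} {k : ℕ} {ε : ℝ}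
    (hr₁ : r₁ < r₀) (hr₀ : 0 < r₀) (h2M : r₀ < 2 * M) (hρ₁ : 1 ≤ ρ₁)
    {D : InitialDataSet (𝓡 3) E3} (hD : NearSchwarzschildCylinder M r₁ r₀ ρ₁ ρ₂ k ε D) {y : E3}
    (hy₁ : ρ₁ < ‖y‖) (hy₂ : ‖y‖ < ρ₂) : 0 ≤ ε := by
  have h := ((nearSchwarzschildCylinder_iff hr₁ hr₀ h2M hρ₁ D).1 hD 0 0 (by simp) (by simp) 0
    (Nat.zero_le _) y hy₁ hy₂).1
  exact (norm_nonneg _).trans h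

/-! ### The inner-layer estimates -/

/-- **The `∂_t`-obstruction of the inner layer is `O(ε)`.** For `r₁ < r₀`, `0 < r₀ < 2M`,
`1 ≤ ρ₁ < t`, `s < ρ₂`, a `C¹` radial profile `χ₀` with `χ₀'` supported in `t ≤ |r| ≤ s`, and a
datum `D` on `E3` that is `ε`-close to the Schwarzschild cylinder on `{ρ₁ < ‖y‖ < ρ₂}`
(`NearSchwarzschildCylinder`), the `∂_t`-integrand of the linearised obstruction on the variation
`(coordH D − G₀, coordK D − K₀)` is integrable over `E3` and
`|∫ (∂_t-integrand)| ≤ K (∫ |χ₀'(‖y‖)| dy) ε` with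
`K = √A (|(M − r₀)/(2r₀²√A)|·4 + 4)` (Li–Mei p. 25, the `(ε₀, …)`-term).
[cite: LiMei2020, proof of Prop. 4.1, p. 25] -/
theorem abs_integral_timeIntegrandWith_data_le [Kerr.Facts] {M r₁ r₀ ρ₁ ρ₂ t s : ℝ} {k : ℕ} {ε : ℝ}
    (hr₁ : r₁ < r₀) (hr₀ : 0 < r₀) (h2M : r₀ < 2 * M) (hρ₁ : 1 ≤ ρ₁) (hρt : ρ₁ < t) (hsρ : s < ρ₂)
    (τ₀ : ℝ) (R₀ : E3 →ₗᵢ[ℝ] E3) {χ₀ : ℝ → ℝ} (hχ : ContDiff ℝ 1 χ₀)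
    (hsupp : ∀ r, deriv χ₀ r ≠ 0 → t ≤ |r| ∧ |r| ≤ s) {D : InitialDataSet (𝓡 3) E3}
    (hD : NearSchwarzschildCylinder M r₁ r₀ ρ₁ ρ₂ k ε D) :
    Integrable (fun y ↦ timeIntegrandWith M r₀ χ₀ (D.coordH y - cylH M 0 r₀ τ₀ R₀ y)
        (D.coordK y - cylK M 0 hr₀ τ₀ R₀ y) y) ∧
      |∫ y, timeIntegrandWith M r₀ χ₀ (D.coordH y - cylH M 0 r₀ τ₀ R₀ y)
          (D.coordK y - cylK M 0 hr₀ τ₀ R₀ y) y| ≤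
        Real.sqrt (2 * M / r₀ - 1) * (|(M - r₀) / (2 * r₀ ^ 2 * Real.sqrt (2 * M / r₀ - 1))| * 4 + 4) *
          (∫ y : E3, |deriv χ₀ ‖y‖|) * ε := by
  obtain ⟨ha0, h₁0, h₂0⟩ := admissible_zero_spin hr₀ h2M
  have hIint : Integrable (fun y : E3 ↦ |deriv χ₀ ‖y‖|) :=
    integrable_abs_deriv_norm_of_support hχ hsupp
  obtain ⟨K, hK⟩ : ∃ K : ℝ, K = Real.sqrt (2 * M / r₀ - 1) *
      (|(M - r₀) / (2 * r₀ ^ 2 * Real.sqrt (2 * M / r₀ - 1))| * 4 + 4) := ⟨_, rfl⟩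
  rw [← hK]
  obtain ⟨F, hF⟩ : ∃ F : E3 → ℝ, F = fun y ↦ timeIntegrandWith M r₀ χ₀
      (D.coordH y - cylH M 0 r₀ τ₀ R₀ y) (D.coordK y - cylK M 0 hr₀ τ₀ R₀ y) y := ⟨_, rfl⟩
  rw [← hF]
  -- the pointwise bound
  have hpt : ∀ y, |F y| ≤ K * ε * |deriv χ₀ ‖y‖| := by
    intro y
    rw [hF]
    dsimp only
    by_cases hd : deriv χ₀ ‖y‖ = 0
    · rw [timeIntegrandWith_eq_zero M r₀ _ _ hd, abs_zero, hd, abs_zero, mul_zero]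
    obtain ⟨hty, hys⟩ := hsupp ‖y‖ hd
    rw [abs_norm] at hty hys
    have hy1 : ρ₁ < ‖y‖ := lt_of_lt_of_le hρt hty
    have hy2 : ‖y‖ < ρ₂ := lt_of_le_of_lt hys hsρ
    obtain ⟨hbH, hbK⟩ := unit_bounds_of_nearSchwarzschildCylinder hr₁ hr₀ h2M hρ₁ τ₀ R₀ hD hy1 hy2
    refine (abs_timeIntegrandWith_le hr₀ h2M χ₀ hbH hbK y).trans (le_of_eq ?_)
    rw [hK]
    ring
  -- measurability and integrability
  have hΓc : Continuous fun y ↦ D.coordH y - cylH M 0 r₀ τ₀ R₀ y :=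
    D.contDiff_coordH.continuous.sub (continuous_cylH hr₀ _ _ τ₀ _)
  have hΚc : Continuous fun y ↦ D.coordK y - cylK M 0 hr₀ τ₀ R₀ y :=
    D.contDiff_coordK.continuous.sub (continuous_cylK ha0 h₁0 h₂0 τ₀ R₀)
  have hmeasF : Measurable F := by
    rw [hF]; exact measurable_timeIntegrandWith hχ hΓc hΚc
  have hFint : Integrable F :=
    Integrable.mono' (hIint.const_mul (K * ε)) hmeasF.aestronglyMeasurable
      (ae_of_all _ fun y ↦ by rw [Real.norm_eq_abs]; exact hpt y)
  refine ⟨hFint, ?_⟩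
  have hle := norm_integral_le_of_norm_le (hIint.const_mul (K * ε))
    (ae_of_all _ fun y ↦ (by rw [Real.norm_eq_abs]; exact hpt y : ‖F y‖ ≤ K * ε * |deriv χ₀ ‖y‖|))
  rw [Real.norm_eq_abs, integral_const_mul] at hle
  calc |∫ y, F y| ≤ K * ε * ∫ y : E3, |deriv χ₀ ‖y‖| := hle
    _ = K * (∫ y : E3, |deriv χ₀ ‖y‖|) * ε := by ring

/-- **The `Ω_ω`-obstruction of the inner layer is `O(ε)`** (`‖ω‖ ≤ 1`), under the same
hypotheses: `|∫ (Ω_ω-integrand)| ≤ (r₀ + r₀²/√A) (∫ |χ₀'(‖y‖)| dy) ε`.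
[cite: LiMei2020, proof of Prop. 4.1, p. 25] -/
theorem abs_integral_rotIntegrandWith_data_le [Kerr.Facts] {M r₁ r₀ ρ₁ ρ₂ t s : ℝ} {k : ℕ} {ε : ℝ}
    (hr₁ : r₁ < r₀) (hr₀ : 0 < r₀) (h2M : r₀ < 2 * M) (hρ₁ : 1 ≤ ρ₁) (hρt : ρ₁ < t) (hsρ : s < ρ₂)
    (τ₀ : ℝ) (R₀ : E3 →ₗᵢ[ℝ] E3) {χ₀ : ℝ → ℝ} (hχ : ContDiff ℝ 1 χ₀)
    (hsupp : ∀ r, deriv χ₀ r ≠ 0 → t ≤ |r| ∧ |r| ≤ s) {D : InitialDataSet (𝓡 3) E3}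
    (hD : NearSchwarzschildCylinder M r₁ r₀ ρ₁ ρ₂ k ε D) {ω : E3} (hω : ‖ω‖ ≤ 1) :
    Integrable (fun y ↦ rotIntegrandWith M r₀ χ₀ ω (D.coordH y - cylH M 0 r₀ τ₀ R₀ y)
        (D.coordK y - cylK M 0 hr₀ τ₀ R₀ y) y) ∧
      |∫ y, rotIntegrandWith M r₀ χ₀ ω (D.coordH y - cylH M 0 r₀ τ₀ R₀ y)
          (D.coordK y - cylK M 0 hr₀ τ₀ R₀ y) y| ≤
        (r₀ + r₀ ^ 2 / Real.sqrt (2 * M / r₀ - 1)) * (∫ y : E3, |deriv χ₀ ‖y‖|) * ε := by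
  obtain ⟨ha0, h₁0, h₂0⟩ := admissible_zero_spin hr₀ h2M
  have hIint : Integrable (fun y : E3 ↦ |deriv χ₀ ‖y‖|) :=
    integrable_abs_deriv_norm_of_support hχ hsupp
  obtain ⟨K, hK⟩ : ∃ K : ℝ, K = r₀ + r₀ ^ 2 / Real.sqrt (2 * M / r₀ - 1) := ⟨_, rfl⟩
  rw [← hK]
  obtain ⟨F, hF⟩ : ∃ F : E3 → ℝ, F = fun y ↦ rotIntegrandWith M r₀ χ₀ ω
      (D.coordH y - cylH M 0 r₀ τ₀ R₀ y) (D.coordK y - cylK M 0 hr₀ τ₀ R₀ y) y := ⟨_, rfl⟩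
  rw [← hF]
  have hpt : ∀ y, |F y| ≤ K * ε * |deriv χ₀ ‖y‖| := by
    intro y
    rw [hF]
    dsimp only
    by_cases hd : deriv χ₀ ‖y‖ = 0
    · rw [rotIntegrandWith_eq_zero M r₀ ω _ _ hd, abs_zero, hd, abs_zero, mul_zero]
    obtain ⟨hty, hys⟩ := hsupp ‖y‖ hd
    rw [abs_norm] at hty hys
    have hy1 : ρ₁ < ‖y‖ := lt_of_lt_of_le hρt hty
    have hy2 : ‖y‖ < ρ₂ := lt_of_le_of_lt hys hsρ
    have hy1' : 1 ≤ ‖y‖ := hρ₁.trans hy1.le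
    obtain ⟨hbH, hbK⟩ := unit_bounds_of_nearSchwarzschildCylinder hr₁ hr₀ h2M hρ₁ τ₀ R₀ hD hy1 hy2
    have hε : 0 ≤ ε := nonneg_of_nearSchwarzschildCylinder hr₁ hr₀ h2M hρ₁ hD hy1 hy2
    have hsA : 0 < Real.sqrt (2 * M / r₀ - 1) := Real.sqrt_pos.2 (lapse_pos hr₀ h2M)
    refine (abs_rotIntegrandWith_le hr₀ h2M χ₀ hω hbH hbK y).trans ?_
    have hnum : 0 ≤ |deriv χ₀ ‖y‖| * (r₀ * ε + r₀ ^ 2 / Real.sqrt (2 * M / r₀ - 1) * ε) := by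
      positivity
    calc |deriv χ₀ ‖y‖| * (r₀ * ε + r₀ ^ 2 / Real.sqrt (2 * M / r₀ - 1) * ε) / ‖y‖
        ≤ |deriv χ₀ ‖y‖| * (r₀ * ε + r₀ ^ 2 / Real.sqrt (2 * M / r₀ - 1) * ε) :=
          div_le_self hnum hy1'
      _ = K * ε * |deriv χ₀ ‖y‖| := by rw [hK]; ring
  have hΓc : Continuous fun y ↦ D.coordH y - cylH M 0 r₀ τ₀ R₀ y :=
    D.contDiff_coordH.continuous.sub (continuous_cylH hr₀ _ _ τ₀ _)
  have hΚc : Continuous fun y ↦ D.coordK y - cylK M 0 hr₀ τ₀ R₀ y :=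
    D.contDiff_coordK.continuous.sub (continuous_cylK ha0 h₁0 h₂0 τ₀ R₀)
  have hmeasF : Measurable F := by
    rw [hF]; exact measurable_rotIntegrandWith hχ ω hΓc hΚc
  have hFint : Integrable F :=
    Integrable.mono' (hIint.const_mul (K * ε)) hmeasF.aestronglyMeasurable
      (ae_of_all _ fun y ↦ by rw [Real.norm_eq_abs]; exact hpt y)
  refine ⟨hFint, ?_⟩
  have hle := norm_integral_le_of_norm_le (hIint.const_mul (K * ε))
    (ae_of_all _ fun y ↦ (by rw [Real.norm_eq_abs]; exact hpt y : ‖F y‖ ≤ K * ε * |deriv χ₀ ‖y‖|))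
  rw [Real.norm_eq_abs, integral_const_mul] at hle
  calc |∫ y, F y| ≤ K * ε * ∫ y : E3, |deriv χ₀ ‖y‖| := hle
    _ = K * (∫ y : E3, |deriv χ₀ ‖y‖|) * ε := by ring

end LiMei

end Literature.Geometry.Lorentzian

end
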